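import Literature.Geometry.ComplexHyperbolic.UnitBallJacobian
import Literature.Geometry.ComplexHyperbolic.UnitBallMeasure
import HarnessLib

/-!
# The lattice sum `∑_γ ‖γ₂₂‖⁻ⁿ` of a corner-finite family in `U(2,1)` — by Euclidean volume

Topic `Geometry/ComplexHyperbolic`; namespace `Literature.Geometry.ComplexHyperbolic.BallModel`
(continuation of `UnitBallU21` / `UnitBallJacobian` / `UnitBallMeasure`).

For a homomorphism `ρ : G →* U(2,1)` which is **corner-finite** — for every `R` only finitely many
`γ` have `‖(ρ γ)₂₂‖ ≤ R`, equivalently (for subgroups) `ρ(G)` acts properly discontinuously on the ball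
`𝔹² ⊂ ℂ²` — the series `∑_γ ‖(ρ γ)₂₂‖⁻ⁿ` converges for every `n ≥ 6`
(`summable_inv_norm_22_pow_of_cornerFinite_subgroup`; in fact finiteness at the single radius `4`
suffices, `summable_inv_norm_22_pow_of_finite_four`). This is the convergence statement behind the Poincaré
series of weight `k ≥ 2` on the ball (Shafarevich, *Basic Algebraic Geometry 2*, Ch. IX §3.1, Lemma;
for `Aut 𝔹ⁿ` and the exponent `n + 1 = 3` cf. Rudin, *Function Theory in the Unit Ball of `ℂⁿ`*,
Thm 2.2.6: the real Jacobian of `ψ ∈ Aut 𝔹ⁿ` is `((1 - |ψ(z)|²)/(1 - |z|²))^{n+1}`).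

## The proof given here (Euclidean volume of translates — Shafarevich's argument, no invariant measure)

Let `B = {z : |z₀|² + |z₁|² < 1/4}`. By the change-of-variables formula for Lebesgue measure on
`ℂ² = ℝ⁴` (Mathlib's `MeasureTheory.lintegral_abs_det_fderiv_eq_addHaar_image`) the Euclidean volume of
the translate `(ρ γ) • B` is `∫_B |det_ℝ D(ρ γ)(z)| dz`, and `det_ℝ D(g)(z) = |det_ℂ D(g)(z)|² =
|det g|² / |w₂|⁶ = 1/|w₂|⁶` with `w₂ = g₂₀ z₀ + g₂₁ z₁ + g₂₂` (`BallModel.det_Jac`,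
`LinearMap.det_restrictScalars`); on `B` one has `|w₂| ≤ 2‖g₂₂‖`, so `vol(g • B) ≥ vol(B)/(64‖g₂₂‖⁶)`.
On the other hand every point of the ball lies in at most `N = #{η : ‖(ρ η)₂₂‖ ≤ 4}` of the translates
(two-point bound `BallModel.norm_entry_le_of_smul_eq`), so `∑_{γ ∈ S} vol((ρ γ) • B) ≤ N · vol(𝔹²)` for
every finite `S`. Hence the partial sums of `∑ ‖(ρ γ)₂₂‖⁻⁶` are bounded, and `‖g₂₂‖ ≥ 1` gives every
`n ≥ 6`.

This is the argument of Shafarevich (loc. cit., proof of the Lemma: the translates `g(U)` of a small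
polycylinder overlap boundedly and `∑ vol(g(U)) = ∑ ∫_U |J_g|²` is dominated by the volume of the
bounded domain), specialised to the ball with the explicit Jacobian.

Main statements: `volume_image_actVec_ge` (the volume lower bound for one translate),
`card_le_of_forall_mem_image` (bounded multiplicity), `sum_inv_norm_22_pow_six_le_of_finite_four`,
`summable_inv_norm_22_pow_of_finite_four` (finiteness of `{γ | ‖(ρ γ)₂₂‖ ≤ 4}` ALONE gives the
lattice sum for all `n ≥ 6`), `summable_inv_norm_22_pow_of_cornerFinite_subgroup` (the consumer
shape: `Δ ≤ U(2,1)` corner-finite).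

This file deliberately imports only `UnitBallJacobian` and `UnitBallMeasure`: it gives a second,
measure-theoretically elementary route to the lattice sum, independent of the Bergman-volume /
group-integral route of `AlgebraicGeometry/ShimuraVarieties/UnitaryBallPoincareSeries.lean`
(`BallPoincare.summable_inv_norm_22_pow`: same conclusion under corner-finiteness at all radii).
[folklore]
-/

set_option autoImplicit false

noncomputable section

open MeasureTheory Matrix Complex Set
open scoped ENNReal

namespace Literature.Geometry.ComplexHyperbolic

namespace BallModel

/-! ### `|det g|² = 1` -/

/-- For `g ∈ U(2,1)` the determinant has `|det g|² = 1` (take determinants in `gᴴ J g = J`).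
[folklore] -/
private theorem normSq_det_mat (g : U21) : Complex.normSq (mat g).det = 1 := by
  have h := congrArg Matrix.det (mat_mem g)
  rw [det_mul, det_mul, det_conjTranspose, det_J] at h
  have h2 : (starRingEnd ℂ) (mat g).det * (mat g).det = 1 := by
    have h' : star (mat g).det * (mat g).det = 1 := by linear_combination -h
    simpa using h'
  have h3 : ((Complex.normSq (mat g).det : ℝ) : ℂ) = 1 := by
    rw [Complex.normSq_eq_conj_mul_self]; exact h2
  exact_mod_cast h3

/-! ### The real Jacobian determinant of `z ↦ g • z` -/

/-- **`det_ℝ D(g)(z) = 1/|w₂|⁶`.** The derivative of the coordinate action `actVec g` at a point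
of the ball, read as a real-linear map of `ℂ² = ℝ⁴`, has determinant `|det_ℂ Jac g z|² =
|det g|²/|w₂|⁶ = |w₂|⁻⁶`, `w₂ = (g·(z,1))₂`. [cite: Rudin1980, Thm 2.2.6] -/
theorem det_restrictScalars_jac (g : U21) (z : Ball) :
    ((LinearMap.toContinuousLinearMap (Matrix.mulVecLin (Jac g z))).restrictScalars ℝ).det
      = (‖W3 g z 2‖ ^ 6)⁻¹ := by
  have h1 : ((LinearMap.toContinuousLinearMap (Matrix.mulVecLin (Jac g z))).restrictScalars ℝ).det
      = LinearMap.det ((Matrix.mulVecLin (Jac g z)).restrictScalars ℝ) := rfl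
  have h2 : Matrix.mulVecLin (Jac g z) = Matrix.toLin' (Jac g z) :=
    LinearMap.ext fun v ↦ by rw [Matrix.mulVecLin_apply, Matrix.toLin'_apply]
  rw [h1, LinearMap.det_restrictScalars, Algebra.norm_complex_apply, h2, LinearMap.det_toLin',
    det_Jac, map_div₀, map_pow, normSq_det_mat, Complex.normSq_eq_norm_sq]
  have hW : ‖W3 g z 2‖ ≠ 0 := norm_ne_zero_iff.2 (W3_2_ne_zero g z)
  field_simp

/-- On the quarter ball `|z|² < 1/4` one has `|w₂| ≤ 2 ‖g₂₂‖` (every entry of `g` is dominated by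
the corner entry). [folklore] -/
private theorem norm_W3_two_le (g : U21) (z : Ball) (hz : nsq z.1 < 1 / 4) :
    ‖W3 g z 2‖ ≤ 2 * ‖mat g 2 2‖ := by
  have hz' : ‖z.1 0‖ ^ 2 + ‖z.1 1‖ ^ 2 < 1 / 4 := hz
  have h0 : ‖z.1 0‖ ≤ 1 / 2 := by
    by_contra h
    rw [not_le] at h
    nlinarith [norm_nonneg (z.1 1), norm_nonneg (z.1 0)]
  have h1 : ‖z.1 1‖ ≤ 1 / 2 := by
    by_contra h
    rw [not_le] at h
    nlinarith [norm_nonneg (z.1 1), norm_nonneg (z.1 0)]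
  rw [W3_apply]
  calc ‖mat g 2 0 * z.1 0 + mat g 2 1 * z.1 1 + mat g 2 2‖
      ≤ ‖mat g 2 0 * z.1 0‖ + ‖mat g 2 1 * z.1 1‖ + ‖mat g 2 2‖ := norm_add₃_le
    _ = ‖mat g 2 0‖ * ‖z.1 0‖ + ‖mat g 2 1‖ * ‖z.1 1‖ + ‖mat g 2 2‖ := by rw [norm_mul, norm_mul]
    _ ≤ ‖mat g 2 2‖ * (1 / 2) + ‖mat g 2 2‖ * (1 / 2) + ‖mat g 2 2‖ := by
        gcongr
        · exact norm_entry_le_norm_22 g 2 0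
        · exact norm_entry_le_norm_22 g 2 1
    _ = 2 * ‖mat g 2 2‖ := by ring

/-- **Pointwise lower bound for the real Jacobian** on the quarter ball:
`det_ℝ D(g)(z) ≥ 1/(64 ‖g₂₂‖⁶)`. [folklore] -/
private theorem inv_le_det_restrictScalars_jac (g : U21) (z : Ball) (hz : nsq z.1 < 1 / 4) :
    (64 * ‖mat g 2 2‖ ^ 6)⁻¹ ≤
      ((LinearMap.toContinuousLinearMap (Matrix.mulVecLin (Jac g z))).restrictScalars ℝ).det := by
  rw [det_restrictScalars_jac]
  have hW : 0 < ‖W3 g z 2‖ := norm_pos_iff.2 (W3_2_ne_zero g z)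
  have hle : ‖W3 g z 2‖ ^ 6 ≤ 64 * ‖mat g 2 2‖ ^ 6 := by
    calc ‖W3 g z 2‖ ^ 6 ≤ (2 * ‖mat g 2 2‖) ^ 6 :=
          pow_le_pow_left₀ hW.le (norm_W3_two_le g z hz) 6
      _ = 64 * ‖mat g 2 2‖ ^ 6 := by ring
  exact inv_anti₀ (pow_pos hW 6) hle

/-! ### The quarter ball and its translates -/

/-- The quarter ball is measurable in `ℂ²`. [folklore] -/
private theorem measurableSet_quarterBall : MeasurableSet {x : Fin 2 → ℂ | nsq x < 1 / 4} :=
  (isOpen_lt continuous_fun_nsq continuous_const).measurableSet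

/-- The quarter ball has positive Lebesgue measure (it is open and contains `0`). [folklore] -/
private theorem volume_quarterBall_pos : 0 < volume {x : Fin 2 → ℂ | nsq x < 1 / 4} := by
  refine (isOpen_lt continuous_fun_nsq continuous_const).measure_pos volume ⟨0, ?_⟩
  show nsq 0 < 1 / 4
  simp [nsq]

/-- The quarter ball lies in the ball. [folklore] -/
private theorem quarterBall_subset : {x : Fin 2 → ℂ | nsq x < 1 / 4} ⊆ {x : Fin 2 → ℂ | nsq x < 1} := by
  intro x hx
  have h : nsq x < 1 / 4 := hx
  show nsq x < 1
  linarith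

/-- The quarter ball has finite Lebesgue measure. [folklore] -/
private theorem volume_quarterBall_lt_top : volume {x : Fin 2 → ℂ | nsq x < 1 / 4} < ⊤ :=
  (measure_mono quarterBall_subset).trans_lt volume_setOf_nsq_lt_lt_top

/-- `actVec g` maps the ball into the ball. [folklore] -/
private theorem nsq_actVec_lt_one (g : U21) (z : Ball) : nsq (actVec g z.1) < 1 := by
  rw [actVec_eq]
  exact (g • z).2

/-- `actVec g` is injective on the ball (the action is by bijections). [folklore] -/
private theorem injOn_actVec (g : U21) : InjOn (actVec g) {x : Fin 2 → ℂ | nsq x < 1} := by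
  intro x hx y hy h
  set zx : Ball := ⟨x, hx⟩ with hzx
  set zy : Ball := ⟨y, hy⟩ with hzy
  have ex : actVec g x = (g • zx).1 := actVec_eq g zx
  have ey : actVec g y = (g • zy).1 := actVec_eq g zy
  have h' : g • zx = g • zy := Subtype.ext (by rw [← ex, ← ey, h])
  have h'' : zx = zy := smul_left_cancel g h'
  have := congrArg Subtype.val h''
  exact this

/-- On the ball, `actVec g` has (real) derivative `Jac g` within any subset. [folklore] -/
private theorem hasFDerivWithinAt_actVec_real (g : U21) (s : Set (Fin 2 → ℂ)) {x : Fin 2 → ℂ}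
    (hx : nsq x < 1) :
    HasFDerivWithinAt (actVec g)
      ((LinearMap.toContinuousLinearMap (Matrix.mulVecLin (Jac g ⟨x, hx⟩))).restrictScalars ℝ)
      s x :=
  ((hasFDerivAt_actVec g ⟨x, hx⟩).restrictScalars ℝ).hasFDerivWithinAt

/-- The image of the quarter ball under `actVec g` is measurable. [folklore] -/
private theorem measurableSet_image_actVec_quarterBall (g : U21) :
    MeasurableSet (actVec g '' {x : Fin 2 → ℂ | nsq x < 1 / 4}) := by
  classical
  refine measurable_image_of_fderivWithin measurableSet_quarterBall
    (f' := fun x ↦ if hx : nsq x < 1 then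
      ((LinearMap.toContinuousLinearMap (Matrix.mulVecLin (Jac g ⟨x, hx⟩))).restrictScalars ℝ)
      else 0) (fun x hx ↦ ?_) ((injOn_actVec g).mono quarterBall_subset)
  have hx1 : nsq x < 1 := quarterBall_subset hx
  simp only [dif_pos hx1]
  exact hasFDerivWithinAt_actVec_real g _ hx1

/-- **Volume of one translate.** The Lebesgue volume of `(ρ γ) • B`, `B` the quarter ball, is at
least `vol(B) / (64 ‖g₂₂‖⁶)`. [cite: Rudin1980, Thm 2.2.6] -/
theorem volume_image_actVec_ge (g : U21) :
    ENNReal.ofReal ((64 * ‖mat g 2 2‖ ^ 6)⁻¹) * volume {x : Fin 2 → ℂ | nsq x < 1 / 4} ≤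
      volume (actVec g '' {x : Fin 2 → ℂ | nsq x < 1 / 4}) := by
  classical
  set f' : (Fin 2 → ℂ) → ((Fin 2 → ℂ) →L[ℝ] (Fin 2 → ℂ)) := fun x ↦ if hx : nsq x < 1 then
      ((LinearMap.toContinuousLinearMap (Matrix.mulVecLin (Jac g ⟨x, hx⟩))).restrictScalars ℝ)
      else 0 with hf'
  have hderiv : ∀ x ∈ {x : Fin 2 → ℂ | nsq x < 1 / 4}, HasFDerivWithinAt (actVec g) (f' x)
      {x : Fin 2 → ℂ | nsq x < 1 / 4} x := by
    intro x hx
    have hx1 : nsq x < 1 := quarterBall_subset hx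
    simp only [hf', dif_pos hx1]
    exact hasFDerivWithinAt_actVec_real g _ hx1
  rw [← lintegral_abs_det_fderiv_eq_addHaar_image volume measurableSet_quarterBall hderiv
    ((injOn_actVec g).mono quarterBall_subset), ← setLIntegral_const]
  refine setLIntegral_mono' measurableSet_quarterBall fun x hx ↦ ?_
  have hx1 : nsq x < 1 := quarterBall_subset hx
  refine ENNReal.ofReal_le_ofReal ?_
  have h := inv_le_det_restrictScalars_jac g ⟨x, hx1⟩ hx
  simp only [hf', dif_pos hx1]
  exact h.trans (le_abs_self _)

/-! ### Bounded multiplicity of the translates -/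

section Multiplicity

variable {G : Type*} [Group G] (ρ : G →* U21)

/-- If `(ρ γ) • B` and `(ρ δ) • B` (images of the quarter ball) share a point, then `ρ (δ⁻¹ γ)`
moves a point of `B` into `B`, hence has corner entry `≤ 4` (two-point bound with `ε = 3/4`).
[cite: Rudin1980, Thm 2.2.2] -/
theorem norm_22_le_four_of_mem_image {γ δ : G} {x : Fin 2 → ℂ}
    (hγ : x ∈ actVec (ρ γ) '' {x : Fin 2 → ℂ | nsq x < 1 / 4})
    (hδ : x ∈ actVec (ρ δ) '' {x : Fin 2 → ℂ | nsq x < 1 / 4}) :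
    ‖mat (ρ (δ⁻¹ * γ)) 2 2‖ ≤ 4 := by
  obtain ⟨b₁, hb₁, hb₁x⟩ := hγ
  obtain ⟨b₂, hb₂, hb₂x⟩ := hδ
  have hb₁4 : nsq b₁ < 1 / 4 := hb₁
  have hb₂4 : nsq b₂ < 1 / 4 := hb₂
  have hb₁' : nsq b₁ < 1 := quarterBall_subset hb₁
  have hb₂' : nsq b₂ < 1 := quarterBall_subset hb₂
  set z₁ : Ball := ⟨b₁, hb₁'⟩ with hz₁
  set z₂ : Ball := ⟨b₂, hb₂'⟩ with hz₂
  have e₁ : actVec (ρ γ) b₁ = (ρ γ • z₁).1 := actVec_eq (ρ γ) z₁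
  have e₂ : actVec (ρ δ) b₂ = (ρ δ • z₂).1 := actVec_eq (ρ δ) z₂
  have h1 : ρ γ • z₁ = ρ δ • z₂ := Subtype.ext (by rw [← e₁, ← e₂, hb₁x, hb₂x])
  have h2 : ρ (δ⁻¹ * γ) • z₁ = z₂ := by
    rw [map_mul, map_inv, mul_smul, h1, inv_smul_smul]
  have hε : (0 : ℝ) < 3 / 4 := by norm_num
  have hz : nsq z₁.1 ≤ 1 - 3 / 4 := by
    show nsq b₁ ≤ 1 - 3 / 4
    linarith
  have hw : nsq z₂.1 ≤ 1 - 3 / 4 := by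
    show nsq b₂ ≤ 1 - 3 / 4
    linarith
  have h := norm_entry_le_of_smul_eq hε hz hw h2 2 2
  linarith

/-- **Bounded multiplicity.** If `ρ` is corner-finite, every point of `ℂ²` lies in at most
`N = #{η | ‖(ρ η)₂₂‖ ≤ 4}` of the translates `(ρ γ) • B`: a finite set `T` of indices whose
translates all contain `x` has `#T ≤ N` — the finiteness-of-overlaps step in the convergence proof
for Poincaré series. [cite: Shafarevich1994, Ch. IX §3.1, proof of the Lemma] -/
theorem card_le_of_forall_mem_image (hfin : {η : G | ‖mat (ρ η) 2 2‖ ≤ 4}.Finite)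
    (T : Finset G) (x : Fin 2 → ℂ)
    (hT : ∀ γ ∈ T, x ∈ actVec (ρ γ) '' {x : Fin 2 → ℂ | nsq x < 1 / 4}) :
    T.card ≤ hfin.toFinset.card := by
  by_cases hTe : T = ∅
  · rw [hTe, Finset.card_empty]
    exact Nat.zero_le _
  obtain ⟨δ, hδ⟩ := Finset.nonempty_iff_ne_empty.2 hTe
  have hδx : x ∈ actVec (ρ δ) '' {x : Fin 2 → ℂ | nsq x < 1 / 4} := hT δ hδ
  refine Finset.card_le_card_of_injOn (fun γ ↦ δ⁻¹ * γ) (fun γ hγ ↦ ?_) ?_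
  · have hγx : x ∈ actVec (ρ γ) '' {x : Fin 2 → ℂ | nsq x < 1 / 4} := hT γ (Finset.mem_coe.1 hγ)
    rw [Finset.mem_coe, Set.Finite.mem_toFinset]
    exact norm_22_le_four_of_mem_image ρ hγx hδx
  · intro γ _ γ' _ h
    exact mul_left_cancel h

/-- **The translates have bounded total volume**: for every finite `S`,
`∑_{γ ∈ S} vol((ρ γ) • B) ≤ N · vol(𝔹²)` — the volume-packing step in the convergence proof for
Poincaré series. [cite: Shafarevich1994, Ch. IX §3.1, proof of the Lemma] -/
theorem sum_volume_image_le (hfin : {η : G | ‖mat (ρ η) 2 2‖ ≤ 4}.Finite) (S : Finset G) :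
    ∑ γ ∈ S, volume (actVec (ρ γ) '' {x : Fin 2 → ℂ | nsq x < 1 / 4}) ≤
      (hfin.toFinset.card : ℝ≥0∞) * volume {x : Fin 2 → ℂ | nsq x < 1} := by
  classical
  have hmeas : ∀ γ : G, MeasurableSet (actVec (ρ γ) '' {x : Fin 2 → ℂ | nsq x < 1 / 4}) :=
    fun γ ↦ measurableSet_image_actVec_quarterBall (ρ γ)
  -- rewrite each volume as the integral of an indicator and exchange sum and integral
  have h1 : ∑ γ ∈ S, volume (actVec (ρ γ) '' {x : Fin 2 → ℂ | nsq x < 1 / 4}) =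
      ∫⁻ x, ∑ γ ∈ S, (actVec (ρ γ) '' {x : Fin 2 → ℂ | nsq x < 1 / 4}).indicator 1 x ∂volume := by
    rw [lintegral_finsetSum' S fun γ _ ↦ ((measurable_one.indicator (hmeas γ)).aemeasurable)]
    refine Finset.sum_congr rfl fun γ _ ↦ ?_
    rw [lintegral_indicator_one (hmeas γ)]
  rw [h1, ← lintegral_indicator_const measurableSet_setOf_nsq_lt]
  refine lintegral_mono fun x ↦ ?_
  -- pointwise: the sum of indicators is the number of translates containing `x`
  by_cases hx : x ∈ {x : Fin 2 → ℂ | nsq x < 1}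
  · simp only [indicator_of_mem hx]
    have hsum : ∑ γ ∈ S, (actVec (ρ γ) '' {x : Fin 2 → ℂ | nsq x < 1 / 4}).indicator
        (1 : (Fin 2 → ℂ) → ℝ≥0∞) x =
        ((S.filter fun γ ↦ x ∈ actVec (ρ γ) '' {x : Fin 2 → ℂ | nsq x < 1 / 4}).card : ℝ≥0∞) := by
      rw [← Finset.sum_boole]
      refine Finset.sum_congr rfl fun γ _ ↦ ?_
      by_cases h : x ∈ actVec (ρ γ) '' {x : Fin 2 → ℂ | nsq x < 1 / 4}
      · rw [indicator_of_mem h, if_pos h]; rfl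
      · rw [indicator_of_notMem h, if_neg h]
    rw [hsum]
    exact Nat.cast_le.2 (card_le_of_forall_mem_image ρ hfin _ x
      fun γ hγ ↦ (Finset.mem_filter.1 hγ).2)
  · -- outside the ball every indicator vanishes
    have hzero : ∀ γ ∈ S, (actVec (ρ γ) '' {x : Fin 2 → ℂ | nsq x < 1 / 4}).indicator
        (1 : (Fin 2 → ℂ) → ℝ≥0∞) x = 0 := by
      intro γ _
      refine indicator_of_notMem (fun hmem ↦ hx ?_) _
      obtain ⟨b, hb, rfl⟩ := hmem
      exact nsq_actVec_lt_one (ρ γ) ⟨b, quarterBall_subset hb⟩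
    rw [Finset.sum_eq_zero hzero]
    exact bot_le

/-! ### The lattice sum -/

/-- **Bounded partial sums.** If only finitely many `γ` have corner entry `‖(ρ γ)₂₂‖ ≤ 4`, there is
`C` with `∑_{γ ∈ S} ‖(ρ γ)₂₂‖⁻⁶ ≤ C` for every finite `S` (explicitly
`C = 64 · N · vol(𝔹²) / vol(B)`, `N = #{γ | ‖(ρ γ)₂₂‖ ≤ 4}`, `B` the quarter ball).
[cite: Shafarevich1994, Ch. IX §3.1, Lemma] -/
theorem sum_inv_norm_22_pow_six_le_of_finite_four (h4 : {γ : G | ‖mat (ρ γ) 2 2‖ ≤ 4}.Finite) :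
    ∃ C : ℝ, ∀ S : Finset G, ∑ γ ∈ S, (‖mat (ρ γ) 2 2‖ ^ 6)⁻¹ ≤ C := by
  classical
  set B : Set (Fin 2 → ℂ) := {x : Fin 2 → ℂ | nsq x < 1 / 4} with hB
  set N : ℕ := h4.toFinset.card with hN
  have hBpos : 0 < volume B := volume_quarterBall_pos
  have hBtop : volume B < ⊤ := volume_quarterBall_lt_top
  have hballtop : volume {x : Fin 2 → ℂ | nsq x < 1} < ⊤ := volume_setOf_nsq_lt_lt_top
  -- the constant: `64 · N · vol(𝔹²) / vol(B)`
  refine ⟨64 * ((N : ℝ≥0∞) * volume {x : Fin 2 → ℂ | nsq x < 1} / volume B).toReal, fun S ↦ ?_⟩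
  -- ENNReal form of the bound on `∑ (64 ‖g₂₂‖⁶)⁻¹`
  have hkey : (∑ γ ∈ S, ENNReal.ofReal ((64 * ‖mat (ρ γ) 2 2‖ ^ 6)⁻¹)) * volume B ≤
      (N : ℝ≥0∞) * volume {x : Fin 2 → ℂ | nsq x < 1} := by
    rw [Finset.sum_mul]
    exact (Finset.sum_le_sum fun γ _ ↦ volume_image_actVec_ge (ρ γ)).trans
      (sum_volume_image_le ρ h4 S)
  have hkey' : ∑ γ ∈ S, ENNReal.ofReal ((64 * ‖mat (ρ γ) 2 2‖ ^ 6)⁻¹) ≤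
      (N : ℝ≥0∞) * volume {x : Fin 2 → ℂ | nsq x < 1} / volume B :=
    (ENNReal.le_div_iff_mul_le (Or.inl hBpos.ne') (Or.inl hBtop.ne)).2 hkey
  have hfin : (N : ℝ≥0∞) * volume {x : Fin 2 → ℂ | nsq x < 1} / volume B ≠ ⊤ :=
    ENNReal.div_ne_top (ENNReal.mul_ne_top (ENNReal.natCast_ne_top N) hballtop.ne) hBpos.ne'
  -- back to real numbers
  have hnonneg : ∀ γ : G, 0 ≤ (64 * ‖mat (ρ γ) 2 2‖ ^ 6)⁻¹ := fun γ ↦ by positivity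
  have hreal : ∑ γ ∈ S, (64 * ‖mat (ρ γ) 2 2‖ ^ 6)⁻¹ ≤
      ((N : ℝ≥0∞) * volume {x : Fin 2 → ℂ | nsq x < 1} / volume B).toReal := by
    rw [← ENNReal.ofReal_le_iff_le_toReal hfin, ENNReal.ofReal_sum_of_nonneg fun γ _ ↦ hnonneg γ]
    exact hkey'
  have hscale : ∑ γ ∈ S, (‖mat (ρ γ) 2 2‖ ^ 6)⁻¹ = 64 * ∑ γ ∈ S, (64 * ‖mat (ρ γ) 2 2‖ ^ 6)⁻¹ := by
    rw [Finset.mul_sum]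
    refine Finset.sum_congr rfl fun γ _ ↦ ?_
    have h : (‖mat (ρ γ) 2 2‖ ^ 6) ≠ 0 := pow_ne_zero 6 (norm_22_pos (ρ γ)).ne'
    field_simp
  rw [hscale]
  exact mul_le_mul_of_nonneg_left hreal (by norm_num)

/-- **The lattice sum from finiteness at ONE radius.** If only finitely many `γ` have corner entry
`‖(ρ γ)₂₂‖ ≤ 4`, then `∑_γ ‖(ρ γ)₂₂‖⁻ⁿ` converges for every `n ≥ 6` (so in particular `ρ` is
corner-finite at every radius). The Euclidean-volume proof needs the finiteness hypothesis only for
the overlaps of the translates of the quarter ball, i.e. at radius `4`; for corner-finite `ρ` (all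
radii — the hypothesis of `BallPoincare.summable_inv_norm_22_pow`) apply this to `hρ 4`.
[cite: Shafarevich1994, Ch. IX §3.1, Lemma] -/
theorem summable_inv_norm_22_pow_of_finite_four (h4 : {γ : G | ‖mat (ρ γ) 2 2‖ ≤ 4}.Finite)
    {n : ℕ} (hn : 6 ≤ n) : Summable fun γ : G ↦ (‖mat (ρ γ) 2 2‖ ^ n)⁻¹ := by
  obtain ⟨C, hC⟩ := sum_inv_norm_22_pow_six_le_of_finite_four ρ h4
  have h6 : Summable fun γ : G ↦ (‖mat (ρ γ) 2 2‖ ^ 6)⁻¹ :=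
    summable_of_sum_le (fun γ ↦ by positivity) hC
  refine h6.of_nonneg_of_le (fun γ ↦ by positivity) fun γ ↦ ?_
  exact inv_anti₀ (pow_pos (norm_22_pos (ρ γ)) 6)
    (pow_le_pow_right₀ (one_le_norm_22 (ρ γ)) hn)

end Multiplicity

/-- **Subgroup form, corner-finite hypothesis.** For a subgroup `Δ ≤ U(2,1)` with finitely many
elements of corner entry `≤ R` for every `R` (e.g. `Δ` acting properly discontinuously on `𝔹²`:
`BallModel.finite_setOf_norm_22_subtype_le`), `∑_{δ ∈ Δ} ‖δ₂₂‖⁻ⁿ` converges for every `n ≥ 6` —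
the hypothesis `hS` of the lattice-sum Poincaré-series lemmas
(`BallPoincare.exists_poincareSeries_immersion_subgroup`, `…_separates_of_latticeSum_subgroup`,
`poincareSeries_mem_holFactorForms_of_latticeSum_subgroup`).
[cite: Shafarevich1994, Ch. IX §3.1, Lemma] -/
theorem summable_inv_norm_22_pow_of_cornerFinite_subgroup (Δ : Subgroup U21)
    (hΔ : ∀ R : ℝ, {δ : Δ | ‖mat (δ : U21) 2 2‖ ≤ R}.Finite) {n : ℕ} (hn : 6 ≤ n) :
    Summable fun δ : Δ ↦ (‖mat (δ : U21) 2 2‖ ^ n)⁻¹ :=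
  summable_inv_norm_22_pow_of_finite_four Δ.subtype (hΔ 4) hn

end BallModel

end Literature.Geometry.ComplexHyperbolic

end
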